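import Literature.Computability.Complexity.LongCodeFourier
import HarnessLib

/-!
# Håstad's 3-SAT test `3S^ε`: the test distribution and its acceptance probability in Fourier terms

Håstad, *Some optimal inapproximability results*, J. ACM 48 (2001), §6.1 (proof of Thm 6.5), for ONE
pair of tables — `A` on the small side (labels `ι`, Håstad's `U`) and `B` on the projected side
(labels `κ`, Håstad's `W`), joined by a projection `π : κ → ι` — everything PROVED:

* the test distribution (Test `3S^ε(u)`, steps 2–4, p. 43 of the author's edition): `f ∈ {0,1}^ι`
  and `g₁ ∈ {0,1}^κ` uniform, and `g₂ = g₁ ⊕ m` where the *mask* `m = mask π f fl` is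
  `m(y) = true` (i.e. `g₂(y) = ¬g₁(y)`) if `f(π y) = false`, and `m(y) = fl(y)` otherwise, the flips
  `fl(y)` being independent `ε`-biased bits (`flipWt ε fl = ∏_y (ε if fl y else 1 - ε)`); in
  Håstad's `±1` notation (`-1` = true): "if `f(y|_U) = 1` then `g₂(y) = -g₁(y)`, if `f(y|_U) = -1`
  then `g₂(y) = g₁(y)` with probability `1 - ε` and `-g₁(y)` otherwise";
* the acceptance predicate "accept unless `A(f) = B(g₁) = B(g₂) = 1`" (`1` = false), i.e. the
  clause `A(f) ∨ B(g₁) ∨ B(g₂)`, and the acceptance probability `accProb ε π A B`;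
* **eq. (33)–(34)**: for folded tables,
  `accProb = 7/8 - (E[b(g₁) b(g₂)] + E[a(f) b(g₁) b(g₂)]) / 8` with both expectations in closed
  Fourier form (`accProb_eq`): writing `s_x = #{y ∈ β | π y = x}` and
  `c^±_ε(s) = ((-1)^s ± (1 - 2ε)^s) / 2` (`cFac`),
  `E[b(g₁) b(g₂)] = ∑_β b̂(β)² ∏_{x ∈ π(β)} c⁺(s_x)` (**eq. (35)–(36)**, `termOne`) and
  `E[a(f) b(g₁) b(g₂)] = ∑_β b̂(β)² ∑_{α ⊆ π(β)} â(α) p(α, β)`,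
  `p(α, β) = ∏_{x ∈ α} c⁻(s_x) ∏_{x ∈ π(β) ∖ α} c⁺(s_x)` (the display before **eq. (42)**, p. 47;
  `termProd`, `termTwo`);
* the two computations behind them: `E_{fl}[χ_β(m)] = ∏_{y ∈ β} e(f(π y))` with `e(true) = 1 - 2ε`,
  `e(false) = -1` (`sum_flipWt_mul_walsh_mask`), and
  `E_{f, fl}[χ_α(f) χ_β(m)] = [α ⊆ π(β)] p(α, β)` (`testE_walsh_mul_walsh`; Håstad: "Lemma 2.29 also
  applies to the case `α ⊄ π(β)`").

Completeness (Lemma 6.6: long codes of a consistent pair of labels are accepted with probability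
one) is `accProb_longCode`.  The estimates of these sums (Lemmas 6.7–6.11) are in later files.

## Conventions

Tables are Boolean (`A : (ι → Bool) → Bool`), read in `±1` by `sgn` (`sgn true = -1`), so Håstad's
"`A(f) = 1`" is `A f = false`; `coeff`, `shift`, `IsFolded`, `sFib` are those of
`LongCodeFourier.lean`.  Probabilities are finite weighted sums over `{0,1}^ι × {0,1}^κ × {0,1}^κ`
(uniform × uniform × `ε`-biased), valid for every real `ε` (the identities are polynomial in `ε`).

## References

* J. Håstad, *Some optimal inapproximability results*, J. ACM 48 (2001) 798–859, §6.1: Test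
  `3S^ε(u)`, Lemma 6.6, eqs. (33)–(36), the formula for `p(α, β)` on p. 47 [Hastad2001].
-/

noncomputable section

namespace Literature.Computability.Complexity.Hastad3Sat

open Finset Literature.Probability.RandomGraphs.LowDegree Literature.Computability.Complexity.LongCode

variable {ι κ : Type*} [Fintype ι] [DecidableEq ι] [Fintype κ] [DecidableEq κ]

/-! ### The test distribution -/

/-- The weight of one `ε`-biased bit: `ε` for `true` (flip), `1 - ε` for `false`.
[cite: Hastad2001, §6.1 (Test 3S, step 4)] -/
def bitWt (ε : ℝ) (b : Bool) : ℝ := if b then ε else 1 - ε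

/-- The weight of a flip pattern `fl ∈ {0,1}^κ`: independent `ε`-biased bits.
[cite: Hastad2001, §6.1 (Test 3S, step 4)] -/
def flipWt (ε : ℝ) (fl : κ → Bool) : ℝ := ∏ y, bitWt ε (fl y)

/-- The mask `m` with `g₂ = g₁ ⊕ m`: `m(y) = fl(y)` if `f(π y)` is true, and `m(y) = true`
(negate `g₁(y)`) if `f(π y)` is false. [cite: Hastad2001, §6.1 (Test 3S, step 4)] -/
def mask (π : κ → ι) (f : ι → Bool) (fl : κ → Bool) : κ → Bool := fun y => if f (π y) then fl y else true

/-- Expectation of a function of `(f, m)` under the test distribution: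
`E[F] = 2^{-|ι|} ∑_f ∑_{fl} flipWt(fl) · F(f, mask π f fl)`. [cite: Hastad2001, §6.1 (Test 3S)] -/
def testE (ε : ℝ) (π : κ → ι) (F : (ι → Bool) → (κ → Bool) → ℝ) : ℝ :=
  (∑ f, ∑ fl, flipWt ε fl * F f (mask π f fl)) / 2 ^ Fintype.card ι

/-- The acceptance indicator of the test: accept unless `A(f)`, `B(g₁)`, `B(g₂)` are all false
(Håstad: "Accept unless `A_U(f) = A_W(g₁) = A_W(g₂) = 1`"). [cite: Hastad2001, §6.1 (Test 3S, step 5)] -/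
def accInd (a b₁ b₂ : Bool) : ℝ := if (a || b₁ || b₂) then 1 else 0

/-- **The acceptance probability of Test `3S^ε`** on the tables `A` (side `U`), `B` (side `W`)
through the projection `π`: the weighted average of the acceptance indicator over
`f, g₁` uniform and the `ε`-biased flips. [cite: Hastad2001, §6.1 (Test 3S)] -/
def accProb (ε : ℝ) (π : κ → ι) (A : (ι → Bool) → Bool) (B : (κ → Bool) → Bool) : ℝ :=
  (∑ f : ι → Bool, ∑ fl : κ → Bool, ∑ g : κ → Bool,
      flipWt ε fl * accInd (A f) (B g) (B (shift g (mask π f fl)))) /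
    (2 ^ Fintype.card ι * 2 ^ Fintype.card κ)

/-! ### Håstad's factors `c^±(s)` and `p(α, β)` -/

/-- Håstad's factor `½((-1)^s ± (1 - 2ε)^s)`; `neg = true` selects the minus sign (used for
`x ∈ α`). [cite: Hastad2001, §6.1 (eq. (36) and p. 47)] -/
def cFac (ε : ℝ) (neg : Bool) (s : ℕ) : ℝ :=
  ((-1) ^ s + (if neg then -1 else 1) * (1 - 2 * ε) ^ s) / 2

/-- `p(α, β) = ∏_{x ∈ π(β) ∩ α} c⁻(s_x) · ∏_{x ∈ π(β) ∖ α} c⁺(s_x)`; for `α = ∅` this is the factor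
`∏_{x ∈ π(β)} ½((-1)^{s_x} + (1 - 2ε)^{s_x})` of eq. (36). [cite: Hastad2001, §6.1 (eq. (36), p. 47)] -/
def termProd (ε : ℝ) (π : κ → ι) (α : Finset ι) (β : Finset κ) : ℝ :=
  ∏ x ∈ β.image π, cFac ε (decide (x ∈ α)) (sFib β π x)

/-- The value `e(b) = E_{fl}[sgn (m y)]` of one masked coordinate given `f(π y) = b`:
`1 - 2ε` if `b` is true, `-1` if false. [cite: Hastad2001, §6.1 (derivation of eq. (36))] -/
def eFac (ε : ℝ) (b : Bool) : ℝ := if b then 1 - 2 * ε else -1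

/-- **Eq. (36)**: `E[b(g₁) b(g₂)] = ∑_β b̂(β)² ∏_{x ∈ π(β)} c⁺(s_x)`. [cite: Hastad2001, eq. (36)] -/
def termOne (ε : ℝ) (π : κ → ι) (B : (κ → Bool) → Bool) : ℝ :=
  ∑ β : Finset κ, coeff (fun g => sgn (B g)) β ^ 2 * termProd ε π ∅ β

/-- The display before eq. (42): `E[a(f) b(g₁) b(g₂)] = ∑_β b̂(β)² ∑_{α ⊆ π(β)} â(α) p(α, β)`.
[cite: Hastad2001, §6.1 (p. 47)] -/
def termTwo (ε : ℝ) (π : κ → ι) (A : (ι → Bool) → Bool) (B : (κ → Bool) → Bool) : ℝ :=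
  ∑ β : Finset κ, coeff (fun g => sgn (B g)) β ^ 2 *
    ∑ α ∈ (β.image π).powerset, coeff (fun f => sgn (A f)) α * termProd ε π α β

/-! ### The flip expectation -/

omit [Fintype ι] [DecidableEq ι] [Fintype κ] [DecidableEq κ] in
/-- `∑_b bitWt ε b = 1`. [cite: Hastad2001, §6.1] -/
theorem sum_bitWt (ε : ℝ) : ∑ b, bitWt ε b = 1 := by
  simp [bitWt]

omit [Fintype ι] [DecidableEq ι] in
/-- The flip weights are a probability distribution: `∑_{fl} flipWt ε fl = 1`. [cite: Hastad2001, §6.1] -/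
theorem sum_flipWt (ε : ℝ) : ∑ fl : κ → Bool, flipWt ε fl = 1 := by
  unfold flipWt
  rw [← Fintype.prod_sum fun (_ : κ) b => bitWt ε b]
  exact prod_eq_one fun y _ => sum_bitWt ε

omit [Fintype ι] [DecidableEq ι] [Fintype κ] [DecidableEq κ] in
/-- One masked coordinate: `E_{fl y}[sgn (m y)] = e(f(π y))`. [cite: Hastad2001, §6.1 (derivation of eq. (36))] -/
theorem sum_bitWt_mul_sgn (ε : ℝ) (c : Bool) :
    ∑ b, bitWt ε b * sgn (if c then b else true) = eFac ε c := by
  rw [Fintype.sum_bool]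
  cases c
  · simp only [bitWt, eFac, sgn, if_true, Bool.false_eq_true, if_false]
    ring
  · simp only [bitWt, eFac, sgn, if_true, Bool.false_eq_true, if_false]
    ring

omit [Fintype ι] [DecidableEq ι] in
/-- **`E_{fl}[χ_β(m)] = ∏_{y ∈ β} e(f(π y))`**: the coordinates of the mask are independent; given
`f(π y)` false the coordinate is surely negated (`sgn = -1`), given `f(π y)` true it is an `ε`-biased
bit (`E sgn = 1 - 2ε`). [cite: Hastad2001, §6.1 (derivation of eq. (36))] -/
theorem sum_flipWt_mul_walsh_mask (ε : ℝ) (π : κ → ι) (f : ι → Bool) (β : Finset κ) :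
    ∑ fl : κ → Bool, flipWt ε fl * walsh β (mask π f fl) = ∏ y ∈ β, eFac ε (f (π y)) := by
  have key : ∀ fl : κ → Bool, flipWt ε fl * walsh β (mask π f fl) =
      ∏ y, (bitWt ε (fl y) * (if y ∈ β then sgn (if f (π y) then fl y else true) else 1)) := by
    intro fl
    rw [flipWt, walsh_eq_prod_ite, ← prod_mul_distrib]
    rfl
  simp_rw [key]
  rw [← Fintype.prod_sum fun y b => bitWt ε b * (if y ∈ β then sgn (if f (π y) then b else true) else 1)]
  rw [← Fintype.prod_ite_mem β fun y => eFac ε (f (π y))]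
  refine prod_congr rfl fun y _ => ?_
  by_cases hy : y ∈ β
  · simp only [hy, if_true]
    exact sum_bitWt_mul_sgn ε (f (π y))
  · simp [hy, bitWt]

omit [Fintype κ] [DecidableEq κ] in
/-- **`E_f[χ_α(f) ∏_{y ∈ β} e(f(π y))] = [α ⊆ π(β)] p(α, β)`** (cleared of the normalisation
`2^{|ι|}`): group the product by fibres (`s_x` factors `e(f x)` over `x`), then average each
coordinate `f x` separately; a coordinate `x ∈ α` outside `π(β)` averages `sgn` to `0`.
[cite: Hastad2001, §6.1 (eq. (36) and p. 47)] -/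
theorem sum_walsh_mul_prod_eFac (ε : ℝ) (π : κ → ι) (α : Finset ι) (β : Finset κ) :
    ∑ f : ι → Bool, walsh α f * ∏ y ∈ β, eFac ε (f (π y)) =
      2 ^ Fintype.card ι * (if α ⊆ β.image π then termProd ε π α β else 0) := by
  -- group the product over `β` by fibres and extend it to all of `ι`
  have hfib : ∀ f : ι → Bool, ∏ y ∈ β, eFac ε (f (π y)) = ∏ x, eFac ε (f x) ^ sFib β π x := by
    intro f
    rw [prod_comp_eq_prod_pow β π fun x => eFac ε (f x)]
    refine prod_subset (subset_univ _) fun x _ hx => ?_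
    rw [sFib_eq_zero β π hx, pow_zero]
  have key : ∀ f : ι → Bool, walsh α f * ∏ y ∈ β, eFac ε (f (π y)) =
      ∏ x, ((if x ∈ α then sgn (f x) else 1) * eFac ε (f x) ^ sFib β π x) := by
    intro f
    rw [hfib, walsh_eq_prod_ite, ← prod_mul_distrib]
  simp_rw [key]
  rw [← Fintype.prod_sum fun x b => (if x ∈ α then sgn b else (1 : ℝ)) * eFac ε b ^ sFib β π x]
  -- each coordinate sums to `2 · cFac`
  have hx : ∀ x, ∑ b, (if x ∈ α then sgn b else (1 : ℝ)) * eFac ε b ^ sFib β π x =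
      2 * cFac ε (decide (x ∈ α)) (sFib β π x) := by
    intro x
    rw [Fintype.sum_bool]
    by_cases hxa : x ∈ α <;> simp [hxa, eFac, cFac, sgn] <;> ring
  simp_rw [hx]
  rw [prod_mul_distrib, prod_const, card_univ]
  congr 1
  -- split the product over `π(β)` and its complement
  rw [← prod_mul_prod_compl (β.image π)]
  have hout : ∀ x ∈ (β.image π)ᶜ, cFac ε (decide (x ∈ α)) (sFib β π x) = if x ∈ α then 0 else 1 := by
    intro x hx
    rw [mem_compl] at hx
    rw [sFib_eq_zero β π hx]
    by_cases hxa : x ∈ α <;> simp [cFac, hxa]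
  rw [prod_congr rfl hout]
  by_cases hsub : α ⊆ β.image π
  · rw [if_pos hsub]
    have h1 : ∏ x ∈ (β.image π)ᶜ, (if x ∈ α then (0 : ℝ) else 1) = 1 :=
      prod_eq_one fun x hx => by
        rw [mem_compl] at hx
        rw [if_neg fun hxa => hx (hsub hxa)]
    rw [h1, mul_one]
    rfl
  · rw [if_neg hsub]
    obtain ⟨x, hxa, hx⟩ := not_subset.1 hsub
    rw [prod_eq_zero (mem_compl.2 hx) (by rw [if_pos hxa]), mul_zero]

/-- **`E_{f, fl}[χ_α(f) χ_β(m)] = [α ⊆ π(β)] p(α, β)`** (Håstad 2001, p. 47: "If `β₁ ≠ β₂` … the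
expected value is `0` …; Lemma 2.29 also applies to the case `α ⊄ π(β)` …; a calculation shows that
`E[χ_α(f) χ_β(g₁ g₂)] = p(α, β)`"). [cite: Hastad2001, §6.1 (p. 47)] -/
theorem testE_walsh_mul_walsh (ε : ℝ) (π : κ → ι) (α : Finset ι) (β : Finset κ) :
    testE ε π (fun f m => walsh α f * walsh β m) =
      if α ⊆ β.image π then termProd ε π α β else 0 := by
  unfold testE
  have e1 : ∀ f : ι → Bool, ∑ fl : κ → Bool, flipWt ε fl * (walsh α f * walsh β (mask π f fl)) =
      walsh α f * ∏ y ∈ β, eFac ε (f (π y)) := by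
    intro f
    rw [← sum_flipWt_mul_walsh_mask ε π f β, mul_sum]
    exact sum_congr rfl fun fl _ => by ring
  simp_rw [e1]
  rw [sum_walsh_mul_prod_eFac, mul_div_cancel_left₀ _ (by positivity)]

/-! ### Linearity of the test expectation -/

/-- `E[F + G] = E[F] + E[G]`. [cite: Hastad2001, §6.1] -/
theorem testE_add (ε : ℝ) (π : κ → ι) (F G : (ι → Bool) → (κ → Bool) → ℝ) :
    testE ε π (fun f m => F f m + G f m) = testE ε π F + testE ε π G := by
  simp only [testE, mul_add, sum_add_distrib, add_div]

/-- `E[F - G] = E[F] - E[G]`. [cite: Hastad2001, §6.1] -/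
theorem testE_sub (ε : ℝ) (π : κ → ι) (F G : (ι → Bool) → (κ → Bool) → ℝ) :
    testE ε π (fun f m => F f m - G f m) = testE ε π F - testE ε π G := by
  simp only [testE, mul_sub, sum_sub_distrib, sub_div]

/-- `E[c F] = c E[F]`. [cite: Hastad2001, §6.1] -/
theorem testE_const_mul (ε : ℝ) (π : κ → ι) (c : ℝ) (F : (ι → Bool) → (κ → Bool) → ℝ) :
    testE ε π (fun f m => c * F f m) = c * testE ε π F := by
  unfold testE
  have h : ∑ f : ι → Bool, ∑ fl : κ → Bool, flipWt ε fl * (c * F f (mask π f fl)) =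
      c * ∑ f : ι → Bool, ∑ fl : κ → Bool, flipWt ε fl * F f (mask π f fl) := by
    rw [Finset.mul_sum]
    refine sum_congr rfl fun f _ => ?_
    rw [Finset.mul_sum]
    refine sum_congr rfl fun fl _ => ?_
    ring
  rw [h, mul_div_assoc]

/-- `E[∑_i F_i] = ∑_i E[F_i]`. [cite: Hastad2001, §6.1] -/
theorem testE_sum (ε : ℝ) (π : κ → ι) {σ : Type*} (s : Finset σ)
    (F : σ → (ι → Bool) → (κ → Bool) → ℝ) :
    testE ε π (fun f m => ∑ i ∈ s, F i f m) = ∑ i ∈ s, testE ε π (F i) := by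
  unfold testE
  rw [← Finset.sum_div]
  congr 1
  have h : ∀ (f : ι → Bool) (fl : κ → Bool), flipWt ε fl * ∑ i ∈ s, F i f (mask π f fl) =
      ∑ i ∈ s, flipWt ε fl * F i f (mask π f fl) := fun f fl => Finset.mul_sum _ _ _
  simp_rw [h]
  calc ∑ f : ι → Bool, ∑ fl : κ → Bool, ∑ i ∈ s, flipWt ε fl * F i f (mask π f fl)
      = ∑ f : ι → Bool, ∑ i ∈ s, ∑ fl : κ → Bool, flipWt ε fl * F i f (mask π f fl) :=
        sum_congr rfl fun f _ => sum_comm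
    _ = ∑ i ∈ s, ∑ f : ι → Bool, ∑ fl : κ → Bool, flipWt ε fl * F i f (mask π f fl) := sum_comm

/-- The expectation of a function of `f` alone is its uniform mean. [cite: Hastad2001, §6.1] -/
theorem testE_left (ε : ℝ) (π : κ → ι) (G : (ι → Bool) → ℝ) :
    testE ε π (fun f _ => G f) = (∑ f, G f) / 2 ^ Fintype.card ι := by
  simp only [testE]
  congr 1
  refine sum_congr rfl fun f _ => ?_
  rw [← sum_mul, sum_flipWt, one_mul]

/-- `E[c] = c`. [cite: Hastad2001, §6.1] -/
theorem testE_const (ε : ℝ) (π : κ → ι) (c : ℝ) : testE ε π (fun _ _ => c) = c := by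
  rw [testE_left]
  simp only [sum_const, card_univ, Fintype.card_fun, Fintype.card_bool, nsmul_eq_mul]
  push_cast
  field_simp

/-- **Eq. (35)–(36)** for one `β`: `E[χ_β(m)] = ∏_{x ∈ π(β)} c⁺(s_x)`. [cite: Hastad2001, eq. (36)] -/
theorem testE_walsh_mask (ε : ℝ) (π : κ → ι) (β : Finset κ) :
    testE ε π (fun _ m => walsh β m) = termProd ε π ∅ β := by
  have h := testE_walsh_mul_walsh ε π ∅ β
  simpa using h

/-! ### The acceptance probability: eqs. (33)–(34) -/

omit [Fintype ι] [DecidableEq ι] [Fintype κ] [DecidableEq κ] in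
/-- **Eq. (33)**: the acceptance indicator is `1 - (1 + a)(1 + b₁)(1 + b₂)/8` in the `±1` reading.
[cite: Hastad2001, eq. (33)] -/
theorem accInd_eq (a b₁ b₂ : Bool) :
    accInd a b₁ b₂ = 1 - (1 + sgn a) * (1 + sgn b₁) * (1 + sgn b₂) / 8 := by
  cases a <;> cases b₁ <;> cases b₂ <;> norm_num [accInd, sgn]

omit [Fintype ι] [DecidableEq ι] in
/-- The `g₁`-average of `(1 + b(g₁))(1 + b(g₁ ⊕ m))` for a folded `B` is `1 + ∑_β b̂(β)² χ_β(m)`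
(cleared of `2^{|κ|}`): the linear terms vanish by folding, the quadratic term is the
autocorrelation. [cite: Hastad2001, §6.1 (from (33) to (34)–(35))] -/
theorem sum_one_add_mul_one_add_shift {B : (κ → Bool) → Bool} (hB : IsFolded B) (m : κ → Bool) :
    ∑ g : κ → Bool, (1 + sgn (B g)) * (1 + sgn (B (shift g m))) =
      2 ^ Fintype.card κ * (1 + ∑ β : Finset κ, coeff (fun g => sgn (B g)) β ^ 2 * walsh β m) := by
  have hodd := hB.isOdd_sgn
  have h1 : ∑ g : κ → Bool, sgn (B g) = 0 := sum_eq_zero_of_isOdd hodd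
  have h2 : ∑ g : κ → Bool, sgn (B (shift g m)) = 0 := by
    rw [sum_shift (fun g => sgn (B g)) m]; exact h1
  have h3 := sum_mul_shift (fun g => sgn (B g)) m
  have e : ∀ g : κ → Bool, (1 + sgn (B g)) * (1 + sgn (B (shift g m))) =
      1 + sgn (B g) + sgn (B (shift g m)) + sgn (B g) * sgn (B (shift g m)) := fun g => by ring
  simp_rw [e]
  rw [sum_add_distrib, sum_add_distrib, sum_add_distrib, h1, h2, h3]
  simp only [sum_const, card_univ, Fintype.card_fun, Fintype.card_bool, nsmul_eq_mul, mul_one]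
  push_cast
  ring

/-- The test expectation of `E[b(g₁) b(g₂) | f, m] = ∑_β b̂(β)² χ_β(m)` is `termOne`
(eq. (35)–(36) summed over `β`). [cite: Hastad2001, eqs. (35)–(36)] -/
theorem testE_weights (ε : ℝ) (π : κ → ι) (B : (κ → Bool) → Bool) :
    testE ε π (fun _ m => ∑ β : Finset κ, coeff (fun g => sgn (B g)) β ^ 2 * walsh β m) =
      termOne ε π B := by
  rw [testE_sum]
  refine sum_congr rfl fun β _ => ?_
  rw [testE_const_mul, testE_walsh_mask]

/-- The test expectation of `a(f) ∑_β b̂(β)² χ_β(m)` is `termTwo` (expand `a` in its Fourier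
series; only `α ⊆ π(β)` survive). [cite: Hastad2001, §6.1 (p. 47)] -/
theorem testE_sgn_mul_weights (ε : ℝ) (π : κ → ι) (A : (ι → Bool) → Bool) (B : (κ → Bool) → Bool) :
    testE ε π (fun f m => sgn (A f) * ∑ β : Finset κ, coeff (fun g => sgn (B g)) β ^ 2 * walsh β m) =
      termTwo ε π A B := by
  have hinv : ∀ f : ι → Bool, sgn (A f) = ∑ α : Finset ι, coeff (fun f => sgn (A f)) α * walsh α f :=
    fun f => (sum_coeff_mul_walsh (fun f => sgn (A f)) f).symm
  have e : ∀ (f : ι → Bool) (m : κ → Bool),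
      sgn (A f) * ∑ β : Finset κ, coeff (fun g => sgn (B g)) β ^ 2 * walsh β m =
        ∑ β : Finset κ, coeff (fun g => sgn (B g)) β ^ 2 *
          ∑ α : Finset ι, coeff (fun f => sgn (A f)) α * (walsh α f * walsh β m) := by
    intro f m
    rw [mul_sum]
    refine sum_congr rfl fun β _ => ?_
    rw [hinv f, sum_mul, mul_sum]
    refine sum_congr rfl fun α _ => ?_
    ring
  simp_rw [e]
  rw [testE_sum]
  refine sum_congr rfl fun β _ => ?_
  rw [testE_const_mul, testE_sum]
  congr 1
  simp_rw [testE_const_mul, testE_walsh_mul_walsh, mul_ite, mul_zero]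
  rw [← sum_filter, Finset.filter_subset_univ]

/-- **Håstad 2001, eq. (34)** (with (35)–(36) and the formula for `p(α, β)`): for folded tables
`A`, `B` the acceptance probability of Test `3S^ε` is
`7/8 - (E[b(g₁) b(g₂)] + E[a(f) b(g₁) b(g₂)]) / 8 = 7/8 - (termOne + termTwo) / 8`.
[cite: Hastad2001, eq. (34)] -/
theorem accProb_eq (ε : ℝ) (π : κ → ι) {A : (ι → Bool) → Bool} {B : (κ → Bool) → Bool}
    (hA : IsFolded A) (hB : IsFolded B) :
    accProb ε π A B = 7 / 8 - (termOne ε π B + termTwo ε π A B) / 8 := by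
  set W : (κ → Bool) → ℝ := fun m => ∑ β : Finset κ, coeff (fun g => sgn (B g)) β ^ 2 * walsh β m
    with hW
  have hN : (2 : ℝ) ^ Fintype.card ι ≠ 0 := by positivity
  have hK : (2 : ℝ) ^ Fintype.card κ ≠ 0 := by positivity
  -- the `g`-sum of the indicator, eq. (33) averaged over `g₁`
  have hg : ∀ (f : ι → Bool) (m : κ → Bool),
      ∑ g : κ → Bool, accInd (A f) (B g) (B (shift g m)) =
        2 ^ Fintype.card κ * (7 / 8 - (sgn (A f) + W m + sgn (A f) * W m) / 8) := by
    intro f m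
    have e : ∀ g : κ → Bool, accInd (A f) (B g) (B (shift g m)) =
        1 - (1 + sgn (A f)) / 8 * ((1 + sgn (B g)) * (1 + sgn (B (shift g m)))) := fun g => by
      rw [accInd_eq]; ring
    simp_rw [e]
    rw [sum_sub_distrib, ← mul_sum, sum_one_add_mul_one_add_shift hB m]
    simp only [sum_const, card_univ, Fintype.card_fun, Fintype.card_bool, nsmul_eq_mul, mul_one]
    push_cast
    ring
  -- hence `accProb` is the test expectation of `7/8 - (a + W + aW)/8`
  have hacc : accProb ε π A B =
      testE ε π (fun f m => 7 / 8 - (sgn (A f) + W m + sgn (A f) * W m) / 8) := by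
    unfold accProb testE
    have e : ∀ (f : ι → Bool) (fl : κ → Bool),
        ∑ g : κ → Bool, flipWt ε fl * accInd (A f) (B g) (B (shift g (mask π f fl))) =
          2 ^ Fintype.card κ *
            (flipWt ε fl * (7 / 8 - (sgn (A f) + W (mask π f fl) + sgn (A f) * W (mask π f fl)) / 8)) := by
      intro f fl
      rw [← mul_sum, hg]
      ring
    simp_rw [e]
    simp_rw [← mul_sum]
    field_simp
  rw [hacc, testE_sub, testE_const]
  congr 1
  have e2 : (fun (f : ι → Bool) (m : κ → Bool) => (sgn (A f) + W m + sgn (A f) * W m) / 8) =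
      fun f m => (1 / 8 : ℝ) * (sgn (A f) + W m + sgn (A f) * W m) := by
    funext f m; ring
  rw [e2, testE_const_mul, testE_add, testE_add, testE_left, sum_eq_zero_of_isOdd hA.isOdd_sgn,
    zero_div, zero_add, hW, testE_weights, testE_sgn_mul_weights]
  ring

/-! ### Completeness (Lemma 6.6) -/

omit [Fintype ι] [DecidableEq ι] [Fintype κ] [DecidableEq κ] in
/-- Long codes of consistent labels pass every instance of the test: if `A` is the long code of
`x₀ = π y₀` and `B` the long code of `y₀`, the indicator is `1` for all `f, g₁, fl`.
[cite: Hastad2001, Lemma 6.6] -/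
theorem accInd_longCode (π : κ → ι) (y₀ : κ) (f : ι → Bool) (g fl : κ → Bool) :
    accInd (f (π y₀)) (g y₀) (shift g (mask π f fl) y₀) = 1 := by
  unfold accInd
  simp only [shift_apply, mask]
  rcases Bool.eq_false_or_eq_true (f (π y₀)) with h | h <;>
    rcases Bool.eq_false_or_eq_true (g y₀) with h' | h' <;> simp [h, h']

/-- **Håstad 2001, Lemma 6.6** (completeness of Test `3S^ε`): the long codes `A = (f ↦ f x₀)`,
`B = (g ↦ g y₀)` of a pair of labels with `π y₀ = x₀` are accepted with probability `1`.
[cite: Hastad2001, Lemma 6.6] -/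
theorem accProb_longCode (ε : ℝ) (π : κ → ι) (y₀ : κ) :
    accProb ε π (fun f => f (π y₀)) (fun g => g y₀) = 1 := by
  unfold accProb
  beta_reduce
  simp only [accInd_longCode, mul_one, sum_const, card_univ, Fintype.card_fun, Fintype.card_bool]
  rw [← smul_sum, sum_flipWt, nsmul_eq_mul, nsmul_eq_mul, mul_one]
  push_cast
  field_simp

/-- Long codes are folded. [cite: Hastad2001, §2.5] -/
theorem isFolded_longCode {σ : Type*} (z : σ) : IsFolded fun (h : σ → Bool) => h z :=
  fun _ => rfl

end Literature.Computability.Complexity.Hastad3Sat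

end
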